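import Literature.AlgebraicGeometry.Resolution.Lipman1969NegativeDefiniteHolds
import Literature.AlgebraicGeometry.Resolution.Lipman1969ClosedPointHolds
import Literature.AlgebraicGeometry.Resolution.ExceptionalPointsFinite
import Literature.AlgebraicGeometry.Resolution.ExceptionalCurvePoints
import HarnessLib

/-!
# Crux `NoZenoR` (stmt-ResolutionOfSingularities-19943): STEP 3 (1) `P ≠ ∅` WITHOUT Lipman (12.1) (i) —
# an effective exceptional Cartier divisor `D ≠ 0` on a desingularization of a two-dimensional normal local
# domain has `(D·E_η) < 0` for some exceptional curve, by du Val negative definiteness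

Route `ResolutionOfSingularities/HomologicalConductor`.  OURS (cell decomp-res, LAND-ONLY hand
leafhand-res-homologicalconduct-12 g0); nothing here is a statement of a manuscript under review; AI-written, weaker than
expert review.  Helper `--supports stmt-ResolutionOfSingularities-19943`.

## What this file does

The (B1) split core of the crux chain consumes the named fact `Lipman1969_12_1_i` (Lipman 1969, Thm. (12.1) (i)) at exactly
ONE node: UP-1′ `ExcCount.exists_excCurveDegree_ne_zero` (`…NoZenoExcDegreeNonzero`) and its corollaries
`exists_excCurveDegree_neg_of_supp_of_ringKrullDim_eq_two` → `exists_excCurveDegree_neg_of_forall_isSection_neg`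
(`…NoZenoExcDegreeAvoids`) → `exists_excCurveDegree_baseIdealDivisor_neg` (`…NoZenoBaseIdealPNonempty`) →
`exists_excCurveDegree_baseIdealDivisor_neg_of_hasRationalSingularity` (`…NoZenoChartFibreCurves`, where `H¹ = 0` is fed by
`Lipman1969_1_2`) → the seam-1 package (`…NoZenoSeam1Package*`).  All of them conclude: *some integral exceptional curve
`E_η` has `(𝒪_X(D)·E_η) < 0`* for an effective Cartier divisor `D ≠ 0` supported on the closed fibre.

Here that conclusion is proved **fact-free and hypothesis-lighter** — no `H¹(X, 𝒪_X) = 0`, no fibre-dimension clause,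
no anti-nefness, no (12.1) (i), no (1.2) — from the tree THEOREM `Lipman1969_14_1_holds` (du Val / Mumford negative
definiteness of `((E_i·E_j))`, `Resolution/Lipman1969NegativeDefiniteHolds`):

* `exists_excCurveDegree_neg_of_isEffective_of_supp` — for `π : X → Spec T` a resolution of a Noetherian normal local
  domain of Krull dimension `2` and `D ≥ 0` a Cartier divisor on `X` avoiding every point off the closed fibre and NOT
  avoiding some point: `(𝒪_X(D)·E_η) < 0` for some `η ∈ excCurvePoints π`;
* `exists_excCurveDegree_ne_zero_of_isEffective_of_supp` — the `≠ 0` form (drop-in for UP-1′ in dimension two);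
* the chart-language forms `…_of_charts` (hypotheses `hoff`/`hx₀` phrased with the local equations `f_i`, the binder shape
  of `exists_excCurveDegree_ne_zero_of_ringKrullDim_eq_two`).

## Proof

Write the Weil cycle of `D`: `F` = the (finite, `excPoints_finite`) set of integral exceptional curves, `a_η = ord_η D ≥ 0`.
Every codimension-one point of the closed fibre is some `η ∈ F` (`IsResolution.mem_excCurvePoints_or_isClosed` + closed points
have codimension two, `Lipman1969_14_closedPoint_holds`), and `D` has order `0` off the closed fibre (it avoids those points), so
`D` and `N := Σ_η a_η [E_η]` have the same order at every codimension-one point (`ord_η [E_η] = 1`,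
`ordAt_ofIsEffectiveCartier_primeDivisorIdeal_self`); on the regular `X` this makes them the same divisor
(`CartierDivisor.sameDivisor_of_forall_ordAt_eq`), hence `(D·E_i) = Σ_j a_j (E_j·E_i)`.  `a ≠ 0` since otherwise `D ∼ 0` would
avoid every point.  Negative definiteness gives `Σ_i a_i (D·E_i) = Σ_i Σ_j a_i a_j (E_j·E_i) < 0`, and as all `a_i ≥ 0` some
`(D·E_i) < 0`.

References: J. Lipman, *Rational singularities, with applications to algebraic surfaces and unique factorization*, Publ. Math.
IHÉS 36 (1969), Lemma (14.1) (p. 224) [`Lipman1969`]; D. Mumford, Publ. Math. IHÉS 9 (1961), p. 6.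
-/

noncomputable section

-- single-problem summit: the doubled namespace component `ResolutionOfSingularities` is forced
set_option linter.dupNamespace false

namespace Summit.ResolutionOfSingularities.ResolutionOfSingularities.Theorems.NoZeno.ExcCount

open CategoryTheory AlgebraicGeometry TopologicalSpace IsLocalRing Order
open Literature.AlgebraicGeometry.Resolution Literature.AlgebraicGeometry.Motives
open Literature.AlgebraicGeometry.Motives.RatFn

universe u

variable {T : Type u} [CommRing T] [IsNoetherianRing T] [IsLocalRing T] [IsDomain T] [IsIntegrallyClosed T]
  {X : Scheme.{u}} [IsIntegral X] [IsLocallyNoetherian X] {π : X ⟶ Spec (.of T)}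

/-- **`P ≠ ∅` by negative definiteness (support language).**  Let `T` be a Noetherian normal local domain of Krull
dimension `2`, `π : X → Spec T` a resolution (proper, birational, `X` regular), and `D ≥ 0` a Cartier divisor on `X` which
avoids every point off the closed fibre and does not avoid some point.  Then `(𝒪_X(D)·E_η) < 0` for some integral
exceptional curve `E_η`.  Fact-free: du Val's lemma `Lipman1969_14_1_holds` applied to the Weil cycle `Σ ord_η(D) [E_η]` of
`D`. [cite: Lipman1969, Lemma (14.1) (p. 224)] -/
theorem exists_excCurveDegree_neg_of_isEffective_of_supp (hdim : ringKrullDim T = 2) (hπ : IsResolution π)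
    (D : CartierDivisor X) (hD : D.IsEffective)
    (hoff : ∀ x : X, π.base x ≠ closedPoint T → D.Avoids x) (hx₀ : ∃ x₀ : X, ¬ D.Avoids x₀) :
    ∃ η ∈ excCurvePoints π, excCurveDegree π D η < 0 := by
  classical
  haveI : IsProper π := hπ.isProper
  have hX : Scheme.IsRegular X := hπ.isRegular
  -- the finite family of ALL integral exceptional curves
  have hfin : (excCurvePoints π).Finite :=
    (excPoints_finite π).subset (hπ.excCurvePoints_subset_excPoints hdim)
  set F : Finset X := hfin.toFinset with hFdef
  have hF : ∀ η ∈ F, η ∈ excCurvePoints π := fun η h => hfin.mem_toFinset.mp h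
  have hη : ∀ i : {η // η ∈ F}, (i : X) ∈ excCurvePoints π := fun i => hF i i.2
  have hco : ∀ i : {η // η ∈ F}, coheight (i : X) = 1 := fun i =>
    hπ.coheight_eq_one_of_mem_excCurvePoints hdim (hη i)
  have hc : ∀ η ∈ F, IsEffectiveCartier (primeDivisorIdeal η) := fun η h =>
    isEffectiveCartier_primeDivisorIdeal_of_isRegular hX (hπ.coheight_eq_one_of_mem_excCurvePoints hdim (hF η h))
  -- every codimension-one point of the closed fibre is one of them
  have hmemF : ∀ z : X, coheight z = 1 → π.base z = closedPoint T → z ∈ F := by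
    intro z hz hzm
    rcases hπ.mem_excCurvePoints_or_isClosed hdim hzm with h | h
    · exact hfin.mem_toFinset.mpr h
    · exfalso
      have h2 := Lipman1969_14_closedPoint_holds T hdim X π hπ z h
      rw [hz] at h2
      exact absurd h2 (by decide)
  -- the prime divisors `E_j`
  set E : {η // η ∈ F} → CartierDivisor X := fun j =>
    CartierDivisor.ofIsEffectiveCartier (primeDivisorIdeal (j : X)) (hc j j.2) with hEdef
  have hEself : ∀ j : {η // η ∈ F}, (E j).ordAt j = 1 := fun j =>
    ordAt_ofIsEffectiveCartier_primeDivisorIdeal_self hX (hco j) (hc j j.2)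
  have hEav : ∀ (j : {η // η ∈ F}) (z : X), ¬ (j : X) ⤳ z → (E j).Avoids z := fun j z hz =>
    (CartierDivisor.avoids_ofIsEffectiveCartier_iff _ (hc j j.2) z).2 (by rwa [mem_support_primeDivisorIdeal_iff])
  -- distinct codimension-one points do not specialise to one another
  have hnsp : ∀ z w : X, coheight z = 1 → coheight w = 1 → z ≠ w → ¬ z ⤳ w := by
    intro z w hz hw hne hsp
    have hlt : w < z := ⟨Scheme.le_iff_specializes.2 hsp,
      fun h' => hne (((Scheme.le_iff_specializes.1 h').antisymm hsp).eq).symm⟩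
    have h1 := Order.coheight_add_one_le hlt
    rw [hz, hw] at h1
    exact absurd h1 (by decide)
  have hEoff : ∀ (j : {η // η ∈ F}) (z : X), coheight z = 1 → z ≠ (j : X) → (E j).ordAt z = 0 :=
    fun j z hz hne => (hEav j z (hnsp (j : X) z (hco j) hz (Ne.symm hne))).ordAt_eq_zero
  have hEoff' : ∀ i j : {η // η ∈ F}, i ≠ j → (E j).ordAt i = 0 := fun i j hij =>
    hEoff j i (hco i) fun h => hij (Subtype.ext h)
  -- off the closed fibre every `E_j` has order `0`
  have hEgen : ∀ (j : {η // η ∈ F}) (z : X), π.base z ≠ closedPoint T → (E j).ordAt z = 0 := by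
    intro j z hz
    refine (hEav j z fun hsp => hz ?_).ordAt_eq_zero
    exact base_eq_closedPoint_of_specializes π (hη j).1 hsp
  -- the coefficients `a_j = ord_j D ≥ 0`
  set a : {η // η ∈ F} → ℕ := fun j => (D.ordAt j).toNat with hadef
  have haZ : ∀ j, (a j : ℤ) = D.ordAt j := fun j => Int.toNat_of_nonneg (hD.ordAt_nonneg _)
  -- finite sums of divisors as iterated sums: orders, degrees
  have hfold_ord : ∀ (l : List (CartierDivisor X)) (z : X),
      (l.foldr (· + ·) 0).ordAt z = (l.map fun D => D.ordAt z).sum := by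
    intro l z
    induction l with
    | nil => simp [CartierDivisor.ordAt_zero]
    | cons D l ih => simp [List.foldr_cons, CartierDivisor.ordAt_add, ih]
  have hfold_deg : ∀ (l : List (CartierDivisor X)) (i : {η // η ∈ F}),
      excCurveDegree π (l.foldr (· + ·) 0) i = (l.map fun D => excCurveDegree π D i).sum := by
    intro l i
    induction l with
    | nil => simp [excCurveDegree_zero π (hη i)]
    | cons D l ih => simp [List.foldr_cons, excCurveDegree_add π (hη i), ih]
  -- the Weil cycle `N = Σ_j a_j [E_j]` of `D`, as a Cartier divisor
  let N : CartierDivisor X :=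
    ((Finset.univ : Finset {η // η ∈ F}).toList.map fun j => a j • E j).foldr (· + ·) 0
  have hNord : ∀ z : X, N.ordAt z = ∑ j, (a j : ℤ) * (E j).ordAt z := by
    intro z
    simp only [N, hfold_ord, List.map_map]
    rw [← Finset.sum_map_toList (Finset.univ : Finset {η // η ∈ F})]
    congr 1
    refine List.map_congr_left fun j _ => ?_
    simp [CartierDivisor.ordAt_smul]
  have hNdeg : ∀ i : {η // η ∈ F}, excCurveDegree π N i = ∑ j, (a j : ℤ) * excCurveDegree π (E j) i := by
    intro i
    simp only [N, hfold_deg, List.map_map]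
    rw [← Finset.sum_map_toList (Finset.univ : Finset {η // η ∈ F})]
    congr 1
    refine List.map_congr_left fun j _ => ?_
    simp [excCurveDegree_smul π (hη i)]
  -- `D` and `N` have the same order at every codimension-one point, hence are the same divisor
  have hsame : D.SameDivisor N := by
    refine CartierDivisor.sameDivisor_of_forall_ordAt_eq hX fun z hz => ?_
    rw [hNord]
    by_cases hzm : π.base z = closedPoint T
    · have hzF : z ∈ F := hmemF z hz hzm
      rw [Finset.sum_eq_single_of_mem (⟨z, hzF⟩ : {η // η ∈ F}) (Finset.mem_univ _)
        fun j _ hj => by rw [hEoff j z hz (fun h => hj (Subtype.ext h).symm), mul_zero]]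
      change D.ordAt z = (a ⟨z, hzF⟩ : ℤ) * (E ⟨z, hzF⟩).ordAt z
      rw [hEself ⟨z, hzF⟩, mul_one, haZ]
    · rw [(hoff z hzm).ordAt_eq_zero]
      exact (Finset.sum_eq_zero fun j _ => by rw [hEgen j z hzm, mul_zero]).symm
  -- `(D·E_i) = Σ_j a_j (E_j·E_i)`
  have hdegD : ∀ i : {η // η ∈ F},
      excCurveDegree π D i = ∑ j, (a j : ℤ) * excCurveDegree π (E j) i := fun i => by
    rw [excCurveDegree_congr_linEquiv π (hη i) hsame.linEquiv, hNdeg]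
  -- `a ≠ 0`: otherwise `D ∼ 0` avoids every point
  have ha0 : (fun j => (a j : ℤ)) ≠ 0 := by
    intro h0
    obtain ⟨x₀, hx₀⟩ := hx₀
    apply hx₀
    have hD0 : D.SameDivisor 0 := by
      refine CartierDivisor.sameDivisor_zero_of_forall_ordAt_eq_zero hX fun z hz => ?_
      rw [hsame.ordAt_eq z, hNord]
      exact Finset.sum_eq_zero fun j _ => by
        have hj : (a j : ℤ) = 0 := congrFun h0 j
        rw [hj, zero_mul]
    exact hD0.symm.avoids (CartierDivisor.avoids_zero x₀)
  -- NEGATIVE DEFINITENESS (du Val, Lipman (14.1) — a theorem of the tree)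
  have h141 := Lipman1969_14_1_holds T hdim X π hπ F hF hc (fun j => (a j : ℤ)) ha0
  have hsum : ∑ i : {η // η ∈ F}, ∑ j, (a i : ℤ) * (a j : ℤ) *
      excCurveDegree π (CartierDivisor.ofIsEffectiveCartier (primeDivisorIdeal (j : X)) (hc j j.2)) i =
      ∑ i : {η // η ∈ F}, (a i : ℤ) * excCurveDegree π D i := by
    refine Finset.sum_congr rfl fun i _ => ?_
    rw [hdegD i, Finset.mul_sum]
    refine Finset.sum_congr rfl fun j _ => ?_
    change (a i : ℤ) * (a j : ℤ) * excCurveDegree π (E j) i = _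
    ring
  rw [hsum] at h141
  -- some term is negative
  by_contra hcon
  push Not at hcon
  have hnn : 0 ≤ ∑ i : {η // η ∈ F}, (a i : ℤ) * excCurveDegree π D i :=
    Finset.sum_nonneg fun i _ => mul_nonneg (Nat.cast_nonneg _) (hcon i (hη i))
  exact absurd h141 (not_lt.mpr hnn)

/-- **`≠ 0` form** (the conclusion shape of UP-1′ `exists_excCurveDegree_ne_zero`, in dimension two, fact-free and without
`H¹ = 0`). [cite: Lipman1969, Lemma (14.1) (p. 224)] -/
theorem exists_excCurveDegree_ne_zero_of_isEffective_of_supp (hdim : ringKrullDim T = 2) (hπ : IsResolution π)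
    (D : CartierDivisor X) (hD : D.IsEffective)
    (hoff : ∀ x : X, π.base x ≠ closedPoint T → D.Avoids x) (hx₀ : ∃ x₀ : X, ¬ D.Avoids x₀) :
    ∃ η ∈ excCurvePoints π, excCurveDegree π D η ≠ 0 := by
  obtain ⟨η, hη, hlt⟩ := exists_excCurveDegree_neg_of_isEffective_of_supp hdim hπ D hD hoff hx₀
  exact ⟨η, hη, hlt.ne⟩

/-- **Chart-language form** (the binder shape of `exists_excCurveDegree_ne_zero_of_ringKrullDim_eq_two`: the local equations
`f_i` of `D ≥ 0` are units at every point of `U_i` off the closed fibre, and a non-unit at some point of some `U_i`), fact-free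
and without `H¹ = 0`: `(𝒪_X(D)·E_η) < 0` for some integral exceptional curve. [cite: Lipman1969, Lemma (14.1) (p. 224)] -/
theorem exists_excCurveDegree_neg_of_isEffective_of_charts (hdim : ringKrullDim T = 2) (hπ : IsResolution π)
    (D : CartierDivisor X) (hD : D.IsEffective)
    (hoff : ∀ (i : D.ι) (x : X), x ∈ D.U i → π.base x ≠ closedPoint T → IsUnitAt x (D.f i))
    (hx₀ : ∃ (i : D.ι) (x₀ : X), x₀ ∈ D.U i ∧ ¬ IsUnitAt x₀ (D.f i)) :
    ∃ η ∈ excCurvePoints π, excCurveDegree π D η < 0 := by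
  refine exists_excCurveDegree_neg_of_isEffective_of_supp hdim hπ D hD (fun x hx i hi => hoff i x hi hx) ?_
  obtain ⟨i, x₀, hi, hu⟩ := hx₀
  exact ⟨x₀, fun hav => hu (hav i hi)⟩

/-- **Chart-language `≠ 0` form** — a drop-in for `exists_excCurveDegree_ne_zero_of_ringKrullDim_eq_two` WITHOUT the binders
`(h121 : Lipman1969_12_1_i)` and `(hH1 : HasTrivialCechH1 π)`. [cite: Lipman1969, Lemma (14.1) (p. 224)] -/
theorem exists_excCurveDegree_ne_zero_of_isEffective_of_charts (hdim : ringKrullDim T = 2) (hπ : IsResolution π)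
    (D : CartierDivisor X) (hD : D.IsEffective)
    (hoff : ∀ (i : D.ι) (x : X), x ∈ D.U i → π.base x ≠ closedPoint T → IsUnitAt x (D.f i))
    (hx₀ : ∃ (i : D.ι) (x₀ : X), x₀ ∈ D.U i ∧ ¬ IsUnitAt x₀ (D.f i)) :
    ∃ η ∈ excCurvePoints π, excCurveDegree π D η ≠ 0 := by
  obtain ⟨η, hη, hlt⟩ := exists_excCurveDegree_neg_of_isEffective_of_charts hdim hπ D hD hoff hx₀
  exact ⟨η, hη, hlt.ne⟩

end Summit.ResolutionOfSingularities.ResolutionOfSingularities.Theorems.NoZeno.ExcCount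

end
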